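import Summits.ResolutionOfSingularities.ResolutionOfSingularities.Theorems.FrobeniusLadderFInjectiveMacaulayficationFDStorey1Charts
import Summits.ResolutionOfSingularities.ResolutionOfSingularities.Theorems.FrobeniusLadderFInjectiveMacaulayficationFDStorey1PIdeal
import Summits.ResolutionOfSingularities.ResolutionOfSingularities.Theorems.FrobeniusLadderFInjectiveMacaulayficationFDStorey1Centre
import Summits.ResolutionOfSingularities.ResolutionOfSingularities.Theorems.FrobeniusLadderFInjectiveMacaulayficationCICertificates
import Summits.ResolutionOfSingularities.ResolutionOfSingularities.Theorems.FrobeniusLadderFInjectiveMacaulayficationFermatCubicConeGerm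
import Literature.AlgebraicGeometry.Resolution.AffineBlowupAlgebra
import Mathlib.AlgebraicGeometry.ProjectiveSpectrum.Basic
import Summits.ResolutionOfSingularities.ResolutionOfSingularities.Theorems.FrobeniusLadderFInjectiveMacaulayficationToricChartFedder
import Summits.ResolutionOfSingularities.ResolutionOfSingularities.Theorems.FrobeniusLadderFInjectiveMacaulayficationRegularBlowupModelDim2
import Summits.ResolutionOfSingularities.ResolutionOfSingularities.Theorems.FrobeniusLadderFInjectiveMacaulayficationDoublePointFermatCubicGerm
import Literature.AlgebraicGeometry.Resolution.BlowupsFlatBaseChange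
import Literature.AlgebraicGeometry.Resolution.AffineBlowupUnique
import HarnessLib

/-!
# ★★ BED D STOREY 1 (D-1): THE BLOWING UP OF `X_D = {z⁴+x⁵z+x⁶+y³+u³+t⁷ = 0}` (char 2) ALONG THE PRODUCT CENTRE `𝔪·K` IS FULL AT EVERY POINT OFF ONE POINT `P`
# — `P` = the point `(Y₀,Y₁,Y₂+1,Y₃,Y₄)` of the chart `D₊(x̄^{m₂₇₇} t) ≅ Spec k[Y]/(g₂₇₇)`, which is NOT F-pure (crux `FInjectiveMacaulayfication` stmt-ResolutionOfSingularities-15315, chain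
# w45a; res-L1-w45a-plan-1 RULING R21.15 (2)(D-1) / R21.16 (2) / R21.18 (4) «Bl_{𝔪·K} X_D is FULL at every stalk off the P-cells of charts 266/277; P not F-pure»; seat res-L1-w45a-stub-2 g10;
# data `FDStorey1{FanTables,PolyTables,CellTables,CoverRecords0–4}` + kernel checks `FDStorey1{FanChecks,CoverChecks,PolyChecks}` + binders `FDStorey1Fan` + charts `FDStorey1Charts`
# + point ideal `FDStorey1PIdeal`; fan = res-L1-w45a-tri-2's `Σ_D^{𝔪K}` 82c555380e5fa685; storey 2 (the blow-up AT `P`) = res-L1-w45a-stub-3's (D-2); glue = res-L1-w45a-stub-1's ✓ `FHalfRowOfTwoStoreys`)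

[OURS · L1 W4.5a] Support file (`--supports stmt-ResolutionOfSingularities-15315 --as helper`); def-free, unconditional; replaces the role of NO printed item;
NOT a statement of the manuscript; AI-written (AI review is weaker than expert review).

SETTING. `R̄ = k[x,y,u,t,z]/(f_D)`, `char k = 2` (ANY field), `v` the vertex; `I_A = span (x̄^A)`, `A = genSet 5 AL2` the certified generator table — `I_A = 𝔪·K` with
`K = span (x̄^(genSet 5 KL2))` (§4, `FDStorey1Fan.span_A_eq_floor_mul_K`); `X₁ = affineBlowup I_A`; the 327 Rees charts `D₊(x̄^{m_c} t) = chartι (x̄^{m_c})` cover `X₁` and are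
the polynomial models `k[Y]/(g_c)` (`FDStorey1Charts`).
* §1 `fullCl_of_not_over_vertex` — off `π⁻¹(v)` the blow-up is a local isomorphism onto the regular scheme `X_D ∖ v` (res-L1-w45a-stub-3's `FDSpecimen.regular_off_vertex`).
* §2 `fullCl_of_goodChart` — over `v`, in the 325 charts `c ∉ {266, 277}`: the whole-chart Fedder cell (`FDStorey1Fan.honStd`) at a maximal ideal above the point's model prime, then
  `FDStorey1Charts.fullCl_stalk_chartι_of_model_clause`. `fullCl_of_PChart` — in the charts 266/277 at every point whose model prime is NOT `𝔪̄_P = (Y₀,Y₁,Y₂+1,Y₃,Y₄)·k[Y]/(g_c)`: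
  a maximal ideal above it other than `𝔪̄_P` (Jacobson, `FDStorey1PIdeal.exists_isMaximal_ne`) carries the off-cell clause `FDStorey1Fan.honOff`.
* §3 `mem_range_chart277_of_chart266_P` — the `𝔪̄_P`-point of chart 266 LIES IN chart 277 (`x̄^{m₂₇₇}/x̄^{m₂₆₆} = Y₂^666` in the model of chart 266 and `Y₂ ∉ 𝔪_P`;
  res `AwayIotaMemBasicOpen`, restated below as `awayι_mem_basicOpen_iff_of_reesChart_mul`), so the only possibly non-FULL point of `X₁` is the `𝔪̄_P`-point `P` of chart 277.
* §4 ★★ `storey1_fullCl_off_P` — THE D-1 THEOREM: an open immersion `ι : Spec k[Y]/(g₂₇₇) ⟶ X₁` (the chart 277 composed with its model isomorphism), compatible with the structure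
  maps (`θ₂₇₇`), such that `X₁` is FULL at EVERY point `≠ ι(P₀)`, `P₀ = 𝔪̄_P`; restated for `X₁ = affineBlowup (𝔪·K)` as `storey1_fullCl_off_P_mul` (the letter of
  `FHalfRowOfTwoStoreys.fHalfConclusion_of_twoStoreys`' first storey; its blow-up/support hypotheses are `FDStorey1Centre.storey1_isBlowup_data`).
HONESTY. `P` is genuinely NOT F-pure (tri-2 #757: the Cartier-root ideal of `g₂₇₇` has zero set `{P}`; kernel: the off-cells need the avoid generators) — storey 2 (D-2) is NEEDED;
this file does not prove `¬ FullCl` at `P` (left to the row assembly). Nothing of [claim: Hironaka2017] is used.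
[folklore glue; cite: Fedder1983, Thm. 1.12; StacksProject, Tag 0804; StacksProject, Tag 080A; GortzWedhorn2020, Prop. 13.91; CoxLittleSchenck2011, §2.3]
-/

-- single-problem summit: the doubled namespace component is forced
set_option linter.dupNamespace false

noncomputable section

open AlgebraicGeometry CategoryTheory Literature.AlgebraicGeometry.Resolution TopologicalSpace IsLocalRing MvPolynomial

namespace Summit.ResolutionOfSingularities.ResolutionOfSingularities.Theorems.FInjectiveMacaulayfication.FDStorey1BlowupFull

open Summit.ResolutionOfSingularities.ResolutionOfSingularities.Theorems.FInjectiveMacaulayfication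
open SliceableCentre FanCheckKit FanCheckSound FDStorey1Fan FDStorey1Charts FDStorey1PIdeal FDStorey1Centre

variable (k : Type) [Field k] [CharP k 2]

/-! ## §1 Off the vertex -/

set_option maxHeartbeats 800000 in
-- one blow-up-is-iso transport
/-- **OFF THE VERTEX `X₁` IS FULL**: `X_D` is regular off `v` (`FDSpecimen.regular_off_vertex`) and the blow-up is a local isomorphism there (`IsBlowup.isIso_compl`).
[cite: GortzWedhorn2020, Prop. 13.91] -/
theorem fullCl_of_not_over_vertex (f : MvPolynomial (Fin 5) k) (hf : f = X 4 ^ 4 + X 0 ^ 5 * X 4 + X 0 ^ 6 + X 1 ^ 3 + X 2 ^ 3 + X 3 ^ 7) :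
    ∀ y : ↥(affineBlowup (Ideal.span ((fun e : Fin 5 →₀ ℕ => Ideal.Quotient.mk (Ideal.span {f}) (monomial e (1 : k))) '' (genSet 5 AL2 : Set (Fin 5 →₀ ℕ))))),
      ¬ Ideal.span (Set.range fun j : Fin 5 => Ideal.Quotient.mk (Ideal.span {f}) (X j)) ≤
        ((affineBlowup.π (Ideal.span ((fun e : Fin 5 →₀ ℕ => Ideal.Quotient.mk (Ideal.span {f}) (monomial e (1 : k))) '' (genSet 5 AL2 : Set (Fin 5 →₀ ℕ))))).base y).asIdeal →
      FullCl 2 ((affineBlowup (Ideal.span ((fun e : Fin 5 →₀ ℕ => Ideal.Quotient.mk (Ideal.span {f}) (monomial e (1 : k))) ''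
        (genSet 5 AL2 : Set (Fin 5 →₀ ℕ))))).presheaf.stalk y) := by
  classical
  haveI : Fact (Nat.Prime 2) := ⟨Nat.prime_two⟩
  haveI hfprime : (Ideal.span {f}).IsPrime := (isPrime_and_mk_X_ne_zero k f hf).1
  haveI : IsDomain (MvPolynomial (Fin 5) k ⧸ Ideal.span {f}) := Ideal.Quotient.isDomain _
  set I : Ideal (MvPolynomial (Fin 5) k ⧸ Ideal.span {f}) :=
    Ideal.span ((fun e : Fin 5 →₀ ℕ => Ideal.Quotient.mk (Ideal.span {f}) (monomial e (1 : k))) '' (genSet 5 AL2 : Set (Fin 5 →₀ ℕ))) with hI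
  intro y hy
  have hyI : ¬ I ≤ ((affineBlowup.π I).base y).asIdeal := fun h => hy ((centre_le_iff k f _).mp h)
  have hreg : (affineBlowup.π I).base y ∈ Scheme.regularLocus (Spec (.of (MvPolynomial (Fin 5) k ⧸ Ideal.span {f}))) :=
    FermatCubicConeGerm.mem_regularLocus_Spec_of_isRegularLocalRing _ (FDSpecimen.regular_off_vertex k f hf _ hy)
  have hsupp : (affineBlowup.π I).base y ∉ ((affineBlowup.idealSheaf I).support : Set (Spec (.of (MvPolynomial (Fin 5) k ⧸ Ideal.span {f})))) := by
    rw [affineBlowup.support_idealSheaf]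
    exact fun h => hyI fun r hr => h hr
  haveI := (affineBlowup.isBlowup I).isIso_compl
  let U : (Spec (.of (MvPolynomial (Fin 5) k ⧸ Ideal.span {f}))).Opens :=
    ⟨((affineBlowup.idealSheaf I).support : Set (Spec (.of (MvPolynomial (Fin 5) k ⧸ Ideal.span {f}))))ᶜ,
      (affineBlowup.idealSheaf I).support.isClosed.isOpen_compl⟩
  have hyU : (affineBlowup.π I).base y ∈ U := hsupp
  have hreg' : y ∈ Scheme.regularLocus (affineBlowup I) := (mem_regularLocus_iff_of_isIso_morphismRestrict (affineBlowup.π I) U y hyU).mpr hreg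
  rw [Scheme.mem_regularLocus] at hreg'
  haveI := hreg'
  haveI := FTemkinClosedPoints.charP_stalk_of_over 2 (Spec.map (CommRingCat.ofHom (algebraMap k (MvPolynomial (Fin 5) k ⧸ Ideal.span {f})))) (affineBlowup.π I) y
  exact FTemkinClosedPoints.fullCl_of_isRegularLocalRing 2 _

/-! ## §2 Over the vertex: good charts, and the P-charts off `𝔪̄_P` -/

/-- The model rings `k[Y]/(g_c)` are Noetherian domains of characteristic 2 (domains: isomorphic to the Rees chart rings of the domain `R̄`). [plumbing] -/
theorem model_instances (f : MvPolynomial (Fin 5) k) (hf : f = X 4 ^ 4 + X 0 ^ 5 * X 4 + X 0 ^ 6 + X 1 ^ 3 + X 2 ^ 3 + X 3 ^ 7) (c : Fin 327)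
    (σ : HomogeneousLocalization.Away
        (reesGrading (Ideal.span ((fun e : Fin 5 →₀ ℕ => Ideal.Quotient.mk (Ideal.span {f}) (monomial e (1 : k))) '' (genSet 5 AL2 : Set (Fin 5 →₀ ℕ)))))
        (reesT (Ideal.Quotient.mk (Ideal.span {f}) (monomial (chartM 5 AL2 CL 327 c) (1 : k))) (mk_vertex_mem k f c)) ≃+*
        (MvPolynomial (Fin 5) k ⧸ Ideal.span {KLocCellKit.evalL k (G c)})) :
    IsDomain (MvPolynomial (Fin 5) k ⧸ Ideal.span {KLocCellKit.evalL k (G c)}) ∧ CharP (MvPolynomial (Fin 5) k ⧸ Ideal.span {KLocCellKit.evalL k (G c)}) 2 := by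
  haveI hfprime : (Ideal.span {f}).IsPrime := (isPrime_and_mk_X_ne_zero k f hf).1
  haveI : IsDomain (MvPolynomial (Fin 5) k ⧸ Ideal.span {f}) := Ideal.Quotient.isDomain _
  haveI := ReesChartRing.isDomain_away _ (mk_vertex_mem k f c) (mk_vertex_ne_zero k f hf c)
  haveI hdom : IsDomain (MvPolynomial (Fin 5) k ⧸ Ideal.span {KLocCellKit.evalL k (G c)}) :=
    Function.Injective.isDomain σ.symm σ.symm.injective
  exact ⟨hdom, charP_of_injective_ringHom (algebraMap k (MvPolynomial (Fin 5) k ⧸ Ideal.span {KLocCellKit.evalL k (G c)})).injective 2⟩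

set_option maxHeartbeats 800000 in
-- chart types
/-- **OVER THE VERTEX, IN A GOOD CHART (`c ∉ {266, 277}`), `X₁` IS FULL**: the point's model prime lies under a maximal ideal of `k[Y]/(g_c)` over the centre, where the whole-chart
Fedder cell gives the clause (`FDStorey1Fan.honStd`); descend and transport (`FDStorey1Charts.fullCl_stalk_chartι_of_model_clause`). [cite: Fedder1983, Thm. 1.12; StacksProject, Tag 0804] -/
theorem fullCl_of_goodChart (f : MvPolynomial (Fin 5) k) (hf : f = X 4 ^ 4 + X 0 ^ 5 * X 4 + X 0 ^ 6 + X 1 ^ 3 + X 2 ^ 3 + X 3 ^ 7)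
    (c : Fin 327) (hc : c.val ≠ 266) (hc' : c.val ≠ 277)
    (q₀ : PrimeSpectrum (HomogeneousLocalization.Away
        (reesGrading (Ideal.span ((fun e : Fin 5 →₀ ℕ => Ideal.Quotient.mk (Ideal.span {f}) (monomial e (1 : k))) '' (genSet 5 AL2 : Set (Fin 5 →₀ ℕ)))))
        (reesT (Ideal.Quotient.mk (Ideal.span {f}) (monomial (chartM 5 AL2 CL 327 c) (1 : k))) (mk_vertex_mem k f c))))
    (hover : Ideal.span (Set.range fun j : Fin 5 => Ideal.Quotient.mk (Ideal.span {f}) (X j)) ≤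
      ((affineBlowup.π _).base ((affineBlowup.chartι (Ideal.Quotient.mk (Ideal.span {f}) (monomial (chartM 5 AL2 CL 327 c) (1 : k))) (mk_vertex_mem k f c)).base q₀)).asIdeal) :
    FullCl 2 ((affineBlowup (Ideal.span ((fun e : Fin 5 →₀ ℕ => Ideal.Quotient.mk (Ideal.span {f}) (monomial e (1 : k))) '' (genSet 5 AL2 : Set (Fin 5 →₀ ℕ))))).presheaf.stalk
      ((affineBlowup.chartι (Ideal.Quotient.mk (Ideal.span {f}) (monomial (chartM 5 AL2 CL 327 c) (1 : k))) (mk_vertex_mem k f c)).base q₀)) := by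
  haveI : Fact (Nat.Prime 2) := ⟨Nat.prime_two⟩
  haveI hfprime : (Ideal.span {f}).IsPrime := (isPrime_and_mk_X_ne_zero k f hf).1
  haveI : IsDomain (MvPolynomial (Fin 5) k ⧸ Ideal.span {f}) := Ideal.Quotient.isDomain _
  haveI : CharP (MvPolynomial (Fin 5) k ⧸ Ideal.span {f}) 2 := charP_of_injective_algebraMap (algebraMap k _).injective 2
  obtain ⟨σ, -, hσ⟩ := exists_modelEquiv k f hf c
  obtain ⟨hdom, hchar⟩ := model_instances k f hf c σ
  haveI := hdom; haveI := hchar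
  -- the model prime of the point and a maximal ideal above it
  set q : Ideal (MvPolynomial (Fin 5) k ⧸ Ideal.span {KLocCellKit.evalL k (G c)}) :=
    q₀.asIdeal.map (σ : _ →+* MvPolynomial (Fin 5) k ⧸ Ideal.span {KLocCellKit.evalL k (G c)}) with hq
  haveI hqp : q.IsPrime := Ideal.map_isPrime_of_equiv σ
  obtain ⟨Q', hQ'max, hqQ'⟩ := Ideal.exists_le_maximal q hqp.ne_top
  have hθ := mk_theta_X_mem_of_over_vertex k f c σ hσ q₀ hover
  have hcl := (honStd k c hc hc' Q' (fun j hj => hqQ' (hθ j hj))).2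
  exact fullCl_stalk_chartι_of_model_clause 2 _ (mk_vertex_mem k f c) σ q₀ Q' hqQ' ⟨inferInstance, hcl⟩

-- chart types
set_option maxHeartbeats 2400000 in
/-- **OVER THE VERTEX, IN A P-CHART (`c ∈ {266, 277}`), OFF `𝔪̄_P`, `X₁` IS FULL**: if the point's model prime is not `𝔪̄_P = 𝔪_P · k[Y]/(g_c)`, a maximal ideal above it OTHER than `𝔪̄_P`
(Jacobson) does not contain all of `Y₀, Y₁, Y₂+1, Y₃, Y₄`, so the off-cell clause `FDStorey1Fan.honOff` applies there. [cite: Fedder1983, Thm. 1.12; StacksProject, Tag 0804] -/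
theorem fullCl_of_PChart (f : MvPolynomial (Fin 5) k) (hf : f = X 4 ^ 4 + X 0 ^ 5 * X 4 + X 0 ^ 6 + X 1 ^ 3 + X 2 ^ 3 + X 3 ^ 7)
    (c : Fin 327) (hc : c.val = 266 ∨ c.val = 277)
    (σ : HomogeneousLocalization.Away
        (reesGrading (Ideal.span ((fun e : Fin 5 →₀ ℕ => Ideal.Quotient.mk (Ideal.span {f}) (monomial e (1 : k))) '' (genSet 5 AL2 : Set (Fin 5 →₀ ℕ)))))
        (reesT (Ideal.Quotient.mk (Ideal.span {f}) (monomial (chartM 5 AL2 CL 327 c) (1 : k))) (mk_vertex_mem k f c)) ≃+*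
        (MvPolynomial (Fin 5) k ⧸ Ideal.span {KLocCellKit.evalL k (G c)}))
    (hσ : ∀ q : MvPolynomial (Fin 5) k,
        σ (reesChartBase (Ideal.Quotient.mk (Ideal.span {f}) (monomial (chartM 5 AL2 CL 327 c) (1 : k))) (mk_vertex_mem k f c)
          (Ideal.Quotient.mk (Ideal.span {f}) q)) =
          Ideal.Quotient.mk (Ideal.span {KLocCellKit.evalL k (G c)}) (aeval (fun j : Fin 5 => ∏ i : Fin 5, (X i : MvPolynomial (Fin 5) k) ^ Vq c i j) q))
    (q₀ : PrimeSpectrum (HomogeneousLocalization.Away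
        (reesGrading (Ideal.span ((fun e : Fin 5 →₀ ℕ => Ideal.Quotient.mk (Ideal.span {f}) (monomial e (1 : k))) '' (genSet 5 AL2 : Set (Fin 5 →₀ ℕ)))))
        (reesT (Ideal.Quotient.mk (Ideal.span {f}) (monomial (chartM 5 AL2 CL 327 c) (1 : k))) (mk_vertex_mem k f c))))
    (hover : Ideal.span (Set.range fun j : Fin 5 => Ideal.Quotient.mk (Ideal.span {f}) (X j)) ≤
      ((affineBlowup.π _).base ((affineBlowup.chartι (Ideal.Quotient.mk (Ideal.span {f}) (monomial (chartM 5 AL2 CL 327 c) (1 : k))) (mk_vertex_mem k f c)).base q₀)).asIdeal)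
    (hP : q₀.asIdeal.map (σ : _ →+* MvPolynomial (Fin 5) k ⧸ Ideal.span {KLocCellKit.evalL k (G c)}) ≠
      (Ideal.span {x | x ∈ HS.map (KLocCellKit.evalL k)}).map (Ideal.Quotient.mk (Ideal.span {KLocCellKit.evalL k (G c)}))) :
    FullCl 2 ((affineBlowup (Ideal.span ((fun e : Fin 5 →₀ ℕ => Ideal.Quotient.mk (Ideal.span {f}) (monomial e (1 : k))) '' (genSet 5 AL2 : Set (Fin 5 →₀ ℕ))))).presheaf.stalk
      ((affineBlowup.chartι (Ideal.Quotient.mk (Ideal.span {f}) (monomial (chartM 5 AL2 CL 327 c) (1 : k))) (mk_vertex_mem k f c)).base q₀)) := by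
  haveI : Fact (Nat.Prime 2) := ⟨Nat.prime_two⟩
  haveI hfprime : (Ideal.span {f}).IsPrime := (isPrime_and_mk_X_ne_zero k f hf).1
  haveI : IsDomain (MvPolynomial (Fin 5) k ⧸ Ideal.span {f}) := Ideal.Quotient.isDomain _
  haveI : CharP (MvPolynomial (Fin 5) k ⧸ Ideal.span {f}) 2 := charP_of_injective_algebraMap (algebraMap k _).injective 2
  obtain ⟨hdom, hchar⟩ := model_instances k f hf c σ
  haveI := hdom; haveI := hchar
  set q : Ideal (MvPolynomial (Fin 5) k ⧸ Ideal.span {KLocCellKit.evalL k (G c)}) :=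
    q₀.asIdeal.map (σ : _ →+* MvPolynomial (Fin 5) k ⧸ Ideal.span {KLocCellKit.evalL k (G c)}) with hq
  haveI hqp : q.IsPrime := Ideal.map_isPrime_of_equiv σ
  -- `𝔪̄_P` is maximal in the model ring (`g_c ∈ 𝔪_P`, `𝔪_P` maximal in `k[Y]`)
  set mP : Ideal (MvPolynomial (Fin 5) k) := Ideal.span {x | x ∈ HS.map (KLocCellKit.evalL k)} with hmP
  have hmPmax : (mP.map (Ideal.Quotient.mk (Ideal.span {KLocCellKit.evalL k (G c)}))).IsMaximal := by
    refine (Ideal.map_eq_top_or_isMaximal_of_surjective _ Ideal.Quotient.mk_surjective (isMaximal_span_HS k)).resolve_left fun htop => ?_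
    have h := congrArg (Ideal.comap (Ideal.Quotient.mk (Ideal.span {KLocCellKit.evalL k (G c)}))) htop
    rw [Ideal.comap_map_of_surjective _ Ideal.Quotient.mk_surjective, Ideal.comap_top, ← RingHom.ker_eq_comap_bot, Ideal.mk_ker,
      sup_eq_left.mpr ((Ideal.span_singleton_le_iff_mem _).mpr (evalL_G_mem_span_HS k c hc))] at h
    exact (isMaximal_span_HS k).ne_top h
  -- a maximal ideal above `q` other than `𝔪̄_P` (Jacobson)
  obtain ⟨Q', hQ'max, hqQ', hQ'ne⟩ := exists_isMaximal_ne q _ hP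
  haveI := hQ'max
  have hnle : ¬ mP.map (Ideal.Quotient.mk (Ideal.span {KLocCellKit.evalL k (G c)})) ≤ Q' :=
    fun hle => hQ'ne (hmPmax.eq_of_le hQ'max.ne_top hle).symm
  have hθ := mk_theta_X_mem_of_over_vertex k f c σ hσ q₀ hover
  have hcl := honOff k c hc Q' (fun j hj => hqQ' (hθ j hj)) hnle
  exact fullCl_stalk_chartι_of_model_clause 2 _ (mk_vertex_mem k f c) σ q₀ Q' hqQ' ⟨inferInstance, hcl⟩

/-! ## §3 The `𝔪̄_P`-point of chart 266 lies in chart 277 -/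

/-- The vertices of the charts 266 and 277, read off the table; the transition exponent `V₂₆₆ · m₂₇₇ = V₂₆₆ · m₂₆₆ + 666 · e₂`. [generated-table reading] -/
theorem vertices_P : ⇑(chartM 5 AL2 CL 327 (266 : Fin 327)) = ![3312, 0, 0, 6, 1338] ∧ ⇑(chartM 5 AL2 CL 327 (277 : Fin 327)) = ![5310, 0, 0, 6, 6] ∧
    (Vq (266 : Fin 327)).mulVec ![5310, 0, 0, 6, 6] = (Vq (266 : Fin 327)).mulVec ![3312, 0, 0, 6, 1338] + Pi.single 2 666 := by
  refine ⟨?_, ?_, by decide +kernel⟩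
  · rw [chartM, coe_expOf]; decide +kernel
  · rw [chartM, coe_expOf]; decide +kernel

/-- **Membership of a chart point of `Bl_I(Spec R)` in another chart** (Stacks 0804: on `D₊(at) = Spec R[I/a]` the open `D₊(at) ∩ D₊(bt)` is the principal open `D(b/a)`):
for `a, b ∈ I`, a point `q` of the chart ring `(R[It])_{(at)}` and the element `w` of the chart ring with `reesChart a ha w · a = b` in `R[1/a]` (i.e. `w = b/a`),
`awayι_{at}(q) ∈ D₊(bt) ↔ w ∉ q` (Mathlib `Proj.awayι_preimage_basicOpen`; `w = (bt)/(at)` by injectivity of `reesChart`).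
Adapted from res `…AwayIotaMemBasicOpen.stub_awayIotaMemBasicOpenIff` (seat c5, 2026-08-17), restated here because that module has no hub olean and cannot be imported.
[cite: StacksProject, Tag 0804] -/
theorem awayι_mem_basicOpen_iff_of_reesChart_mul {R : Type} [CommRing R] {I : Ideal R} {a b : R} (ha : a ∈ I) (hb : b ∈ I)
    (q : PrimeSpectrum (HomogeneousLocalization.Away (reesGrading I) (reesT a ha)))
    (w : HomogeneousLocalization.Away (reesGrading I) (reesT a ha))
    (hw : reesChart a ha w * algebraMap R (Localization.Away a) a = algebraMap R (Localization.Away a) b) :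
    (Proj.awayι (reesGrading I) (reesT a ha) (reesT_mem a ha) Nat.one_pos).base q ∈ Proj.basicOpen (reesGrading I) (reesT b hb) ↔
      w ∉ q.asIdeal := by
  -- `reesChart ((bt)/(at)) = b · a⁻¹`
  have h1 : reesChart a ha (HomogeneousLocalization.Away.isLocalizationElem (reesT_mem a ha) (reesT_mem b hb)) =
      algebraMap R (Localization.Away a) b * IsLocalization.Away.invSelf a := by
    have hr : (((reesT b hb) ^ 1 : reesAlgebra I) : Polynomial R) = Polynomial.monomial 1 b := by
      rw [pow_one, coe_reesT]
    rw [← pow_one (IsLocalization.Away.invSelf a)]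
    exact reesChart_mk a ha (n := 1) (x := (reesT b hb) ^ 1) _ hr
  -- `w = (bt)/(at)`: `reesChart` is injective and `a` is a unit of `R[1/a]`
  have hw' : w = HomogeneousLocalization.Away.isLocalizationElem (reesT_mem a ha) (reesT_mem b hb) := by
    apply reesChart_injective a ha
    rw [h1]
    refine (IsUnit.mul_left_inj (IsLocalization.Away.algebraMap_isUnit (S := Localization.Away a) a)).mp ?_
    rw [hw, div_mul_algebraMap]
  subst hw'
  change q ∈ Proj.awayι (reesGrading I) (reesT a ha) (reesT_mem a ha) Nat.one_pos ⁻¹ᵁ Proj.basicOpen (reesGrading I) (reesT b hb) ↔ _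
  rw [Proj.awayι_preimage_basicOpen (reesGrading I) (reesT_mem a ha) Nat.one_pos (reesT_mem b hb) Nat.one_pos]
  exact PrimeSpectrum.mem_basicOpen _ q

set_option maxHeartbeats 1600000 in
set_option synthInstance.maxHeartbeats 400000 in
-- chart types
/-- **THE `𝔪̄_P`-POINT OF CHART 266 LIES IN CHART 277.** In the model of chart 266, `x̄^{m₂₇₇}/x̄^{m₂₆₆} = Y₂^666` (`θ₂₆₆(x^{m₂₇₇}) = θ₂₆₆(x^{m₂₆₆}) · Y₂^666`), and `Y₂ ∉ 𝔪_P`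
(`Y₂ + 1 ∈ 𝔪_P`); by the chart-membership criterion (`awayι_mem_basicOpen_iff_of_reesChart_mul`, Stacks 0804) the point lies in `D₊(x̄^{m₂₇₇} t)`. [cite: StacksProject, Tag 0804] -/
theorem mem_range_chart277_of_chart266_P (f : MvPolynomial (Fin 5) k)
    (σ : HomogeneousLocalization.Away
        (reesGrading (Ideal.span ((fun e : Fin 5 →₀ ℕ => Ideal.Quotient.mk (Ideal.span {f}) (monomial e (1 : k))) '' (genSet 5 AL2 : Set (Fin 5 →₀ ℕ)))))
        (reesT (Ideal.Quotient.mk (Ideal.span {f}) (monomial (chartM 5 AL2 CL 327 (266 : Fin 327)) (1 : k))) (mk_vertex_mem k f 266)) ≃+*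
        (MvPolynomial (Fin 5) k ⧸ Ideal.span {KLocCellKit.evalL k (G (266 : Fin 327))}))
    (hB : ∀ q : MvPolynomial (Fin 5) k,
        ((reesChartEquiv (Ideal.Quotient.mk (Ideal.span {f}) (monomial (chartM 5 AL2 CL 327 (266 : Fin 327)) (1 : k))) (mk_vertex_mem k f 266))
          (σ.symm (Ideal.Quotient.mk (Ideal.span {KLocCellKit.evalL k (G (266 : Fin 327))})
            (aeval (fun j : Fin 5 => ∏ i : Fin 5, (X i : MvPolynomial (Fin 5) k) ^ Vq (266 : Fin 327) i j) q))) :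
            Localization.Away (Ideal.Quotient.mk (Ideal.span {f}) (monomial (chartM 5 AL2 CL 327 (266 : Fin 327)) (1 : k)))) =
          algebraMap (MvPolynomial (Fin 5) k ⧸ Ideal.span {f}) _ (Ideal.Quotient.mk (Ideal.span {f}) q))
    (q₀ : PrimeSpectrum (HomogeneousLocalization.Away
        (reesGrading (Ideal.span ((fun e : Fin 5 →₀ ℕ => Ideal.Quotient.mk (Ideal.span {f}) (monomial e (1 : k))) '' (genSet 5 AL2 : Set (Fin 5 →₀ ℕ)))))
        (reesT (Ideal.Quotient.mk (Ideal.span {f}) (monomial (chartM 5 AL2 CL 327 (266 : Fin 327)) (1 : k))) (mk_vertex_mem k f 266))))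
    (hq : q₀.asIdeal.map (σ : _ →+* MvPolynomial (Fin 5) k ⧸ Ideal.span {KLocCellKit.evalL k (G (266 : Fin 327))}) =
      (Ideal.span {x | x ∈ HS.map (KLocCellKit.evalL k)}).map (Ideal.Quotient.mk (Ideal.span {KLocCellKit.evalL k (G (266 : Fin 327))}))) :
    ∃ q₀' : PrimeSpectrum (HomogeneousLocalization.Away
        (reesGrading (Ideal.span ((fun e : Fin 5 →₀ ℕ => Ideal.Quotient.mk (Ideal.span {f}) (monomial e (1 : k))) '' (genSet 5 AL2 : Set (Fin 5 →₀ ℕ)))))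
        (reesT (Ideal.Quotient.mk (Ideal.span {f}) (monomial (chartM 5 AL2 CL 327 (277 : Fin 327)) (1 : k))) (mk_vertex_mem k f 277))),
      (affineBlowup.chartι (Ideal.Quotient.mk (Ideal.span {f}) (monomial (chartM 5 AL2 CL 327 (277 : Fin 327)) (1 : k))) (mk_vertex_mem k f 277)).base q₀' =
        (affineBlowup.chartι (Ideal.Quotient.mk (Ideal.span {f}) (monomial (chartM 5 AL2 CL 327 (266 : Fin 327)) (1 : k))) (mk_vertex_mem k f 266)).base q₀ := by
  classical
  obtain ⟨h266, h277, hmul⟩ := vertices_P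
  -- `θ₂₆₆(x^{m₂₇₇}) = θ₂₆₆(x^{m₂₆₆}) · Y₂^666`
  have hθ : aeval (fun j : Fin 5 => ∏ i : Fin 5, (X i : MvPolynomial (Fin 5) k) ^ Vq (266 : Fin 327) i j)
        (monomial (chartM 5 AL2 CL 327 (277 : Fin 327)) (1 : k)) =
      aeval (fun j : Fin 5 => ∏ i : Fin 5, (X i : MvPolynomial (Fin 5) k) ^ Vq (266 : Fin 327) i j)
        (monomial (chartM 5 AL2 CL 327 (266 : Fin 327)) (1 : k)) * X 2 ^ 666 := by
    rw [ToricChartFedder.theta_monomial, ToricChartFedder.theta_monomial, h266, h277, hmul, Q6CNKit.symm_add,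
      Finsupp.equivFunOnFinite_symm_single, X_pow_eq_monomial, monomial_mul, mul_one]
  -- push through `mk`, `σ⁻¹`, `reesChartEquiv`, `val`
  have h1 := congrArg (fun z => ((reesChartEquiv (Ideal.Quotient.mk (Ideal.span {f}) (monomial (chartM 5 AL2 CL 327 (266 : Fin 327)) (1 : k))) (mk_vertex_mem k f 266))
      (σ.symm (Ideal.Quotient.mk (Ideal.span {KLocCellKit.evalL k (G (266 : Fin 327))}) z)) :
        Localization.Away (Ideal.Quotient.mk (Ideal.span {f}) (monomial (chartM 5 AL2 CL 327 (266 : Fin 327)) (1 : k))))) hθ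
  simp only [RingHom.map_mul, RingEquiv.map_mul, Subalgebra.coe_mul] at h1
  rw [hB, hB, coe_reesChartEquiv] at h1
  -- `h1 : u'/1 = u/1 * reesChart w`
  have hwu : reesChart (Ideal.Quotient.mk (Ideal.span {f}) (monomial (chartM 5 AL2 CL 327 (266 : Fin 327)) (1 : k))) (mk_vertex_mem k f 266)
        (σ.symm (Ideal.Quotient.mk (Ideal.span {KLocCellKit.evalL k (G (266 : Fin 327))}) (X 2 ^ 666))) *
        algebraMap _ (Localization.Away (Ideal.Quotient.mk (Ideal.span {f}) (monomial (chartM 5 AL2 CL 327 (266 : Fin 327)) (1 : k))))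
          (Ideal.Quotient.mk (Ideal.span {f}) (monomial (chartM 5 AL2 CL 327 (266 : Fin 327)) (1 : k))) =
      algebraMap _ (Localization.Away (Ideal.Quotient.mk (Ideal.span {f}) (monomial (chartM 5 AL2 CL 327 (266 : Fin 327)) (1 : k))))
        (Ideal.Quotient.mk (Ideal.span {f}) (monomial (chartM 5 AL2 CL 327 (277 : Fin 327)) (1 : k))) := by
    rw [mul_comm, ← h1]
  -- `w ∉ q₀`: otherwise `Y₂^666 ∈ 𝔪̄_P`, i.e. `Y₂ ∈ 𝔪_P`
  have hwq : σ.symm (Ideal.Quotient.mk (Ideal.span {KLocCellKit.evalL k (G (266 : Fin 327))}) (X 2 ^ 666)) ∉ q₀.asIdeal := by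
    intro hmem
    have h2 : σ (σ.symm (Ideal.Quotient.mk (Ideal.span {KLocCellKit.evalL k (G (266 : Fin 327))}) (X 2 ^ 666))) ∈
        q₀.asIdeal.map (σ : _ →+* MvPolynomial (Fin 5) k ⧸ Ideal.span {KLocCellKit.evalL k (G (266 : Fin 327))}) := Ideal.mem_map_of_mem _ hmem
    rw [RingEquiv.apply_symm_apply, hq, map_pow] at h2
    haveI : ((Ideal.span {x | x ∈ HS.map (KLocCellKit.evalL k)}).map (Ideal.Quotient.mk (Ideal.span {KLocCellKit.evalL k (G (266 : Fin 327))}))).IsPrime := by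
      rw [← hq]; exact Ideal.map_isPrime_of_equiv σ
    have h3 : (X 2 : MvPolynomial (Fin 5) k) ∈ ((Ideal.span {x | x ∈ HS.map (KLocCellKit.evalL k)}).map
        (Ideal.Quotient.mk (Ideal.span {KLocCellKit.evalL k (G (266 : Fin 327))}))).comap (Ideal.Quotient.mk (Ideal.span {KLocCellKit.evalL k (G (266 : Fin 327))})) :=
      Ideal.mem_comap.mpr (Ideal.IsPrime.mem_of_pow_mem ‹_› 666 h2)
    rw [Ideal.comap_map_of_surjective _ Ideal.Quotient.mk_surjective, ← RingHom.ker_eq_comap_bot, Ideal.mk_ker,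
      sup_eq_left.mpr ((Ideal.span_singleton_le_iff_mem _).mpr (evalL_G_mem_span_HS k 266 (Or.inl rfl)))] at h3
    exact X2_not_mem_span_HS k h3
  have hmem := (awayι_mem_basicOpen_iff_of_reesChart_mul (mk_vertex_mem k f 266) (mk_vertex_mem k f 277) q₀ _ hwu).mpr hwq
  rw [← Proj.opensRange_awayι (reesGrading _) (reesT _ (mk_vertex_mem k f 277)) (reesT_mem _ (mk_vertex_mem k f 277)) Nat.one_pos] at hmem
  exact Scheme.Hom.mem_opensRange.mp hmem

/-! ## §4 ★★ The D-1 theorem -/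

omit [CharP k 2] in
/-- `Spec` of a ring isomorphism pulls `σ(I)` back to `I` (generic, small types: keeps the defeq checks out of the chart context). [plumbing] -/
theorem comap_iso_hom_map {A B : Type} [CommRing A] [CommRing B] (σ : A ≃+* B) (I : Ideal A) :
    Ideal.comap (σ.toCommRingCatIso.hom).hom (I.map (σ : A →+* B)) = I := by
  rw [RingEquiv.toCommRingCatIso_hom, CommRingCat.hom_ofHom]
  exact Ideal.comap_map_of_bijective (σ : A →+* B) σ.bijective


set_option maxHeartbeats 3200000 in
set_option synthInstance.maxHeartbeats 400000 in
-- chart types; a five-way case analysis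
/-- ★★ **BED D STOREY 1: `Bl_{I_A} X_D` IS FULL AT EVERY POINT OFF THE POINT `P` OF CHART 277.** There is an open immersion `ι : Spec k[Y]/(g₂₇₇) ⟶ X₁ = affineBlowup I_A`
(the Rees chart `D₊(x̄^{m₂₇₇} t)` composed with its polynomial model), compatible with the structure maps — `π ∘ ι` is induced by the chart map `θ₂₇₇ : x_j ↦ ∏ᵢ Yᵢ^{V i j}` —,
such that for the point `P₀` of `Spec k[Y]/(g₂₇₇)` with ideal `𝔪̄_P = (Y₀, Y₁, Y₂+1, Y₃, Y₄)` (the avoid generators `HS`): `X₁` is FULL at EVERY point `y ≠ ι P₀`.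
PROOF: off `π⁻¹(v)` §1; over `v` every point lies in a Rees chart (`FDStorey1Charts.exists_chart`): a good chart §2, a P-chart off `𝔪̄_P` §2, the `𝔪̄_P`-point of chart 266 is
moved to chart 277 by §3, and the `𝔪̄_P`-point of chart 277 IS `ι P₀`. [OURS · certificate instance; cite: Fedder1983, Thm. 1.12; StacksProject, Tag 0804; GortzWedhorn2020, Prop. 13.91] -/
theorem storey1_fullCl_off_P (f : MvPolynomial (Fin 5) k) (hf : f = X 4 ^ 4 + X 0 ^ 5 * X 4 + X 0 ^ 6 + X 1 ^ 3 + X 2 ^ 3 + X 3 ^ 7) :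
    ∃ ι : Spec (.of (MvPolynomial (Fin 5) k ⧸ Ideal.span {KLocCellKit.evalL k (G (277 : Fin 327))})) ⟶
        affineBlowup (Ideal.span ((fun e : Fin 5 →₀ ℕ => Ideal.Quotient.mk (Ideal.span {f}) (monomial e (1 : k))) '' (genSet 5 AL2 : Set (Fin 5 →₀ ℕ)))),
      IsOpenImmersion ι ∧
      (∀ q : Spec (.of (MvPolynomial (Fin 5) k ⧸ Ideal.span {KLocCellKit.evalL k (G (277 : Fin 327))})),
        ((affineBlowup.π _).base (ι.base q)).asIdeal.comap (Ideal.Quotient.mk (Ideal.span {f})) =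
          q.asIdeal.comap ((Ideal.Quotient.mk (Ideal.span {KLocCellKit.evalL k (G (277 : Fin 327))})).comp
            (aeval (fun j : Fin 5 => ∏ i : Fin 5, (X i : MvPolynomial (Fin 5) k) ^ Vq (277 : Fin 327) i j)).toRingHom)) ∧
      ∀ P₀ : Spec (.of (MvPolynomial (Fin 5) k ⧸ Ideal.span {KLocCellKit.evalL k (G (277 : Fin 327))})),
        P₀.asIdeal = (Ideal.span {x | x ∈ HS.map (KLocCellKit.evalL k)}).map (Ideal.Quotient.mk (Ideal.span {KLocCellKit.evalL k (G (277 : Fin 327))})) →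
        ∀ y : ↥(affineBlowup (Ideal.span ((fun e : Fin 5 →₀ ℕ => Ideal.Quotient.mk (Ideal.span {f}) (monomial e (1 : k))) '' (genSet 5 AL2 : Set (Fin 5 →₀ ℕ))))),
          y ≠ ι.base P₀ →
          FullCl 2 ((affineBlowup (Ideal.span ((fun e : Fin 5 →₀ ℕ => Ideal.Quotient.mk (Ideal.span {f}) (monomial e (1 : k))) ''
            (genSet 5 AL2 : Set (Fin 5 →₀ ℕ))))).presheaf.stalk y) := by
  classical
  obtain ⟨σ, hB, hσ⟩ := exists_modelEquiv k f hf 277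
  refine ⟨Spec.map σ.toCommRingCatIso.hom ≫ affineBlowup.chartι _ (mk_vertex_mem k f 277), inferInstance, fun q => ?_, ?_⟩
  · -- compatibility with the structure maps
    rw [Scheme.Hom.comp_base, TopCat.coe_comp, Function.comp_apply, comap_asIdeal_π_chartι, Spec.map_apply, RingEquiv.toCommRingCatIso_hom,
      CommRingCat.hom_ofHom, PrimeSpectrum.comap_asIdeal, Ideal.comap_comap, Ideal.comap_comap]
    congr 1
    refine RingHom.ext fun r => ?_
    rw [RingHom.comp_apply, RingHom.comp_apply, RingHom.comp_apply]
    exact hσ r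
  · intro P₀ hP₀ y hy
    by_cases hover : Ideal.span (Set.range fun j : Fin 5 => Ideal.Quotient.mk (Ideal.span {f}) (X j)) ≤ ((affineBlowup.π _).base y).asIdeal
    swap
    · exact fullCl_of_not_over_vertex k f hf y hover
    obtain ⟨c, q₀, rfl⟩ := exists_chart k f y
    -- the `𝔪̄_P`-point of chart 277 is `ι P₀`; every other point of chart 277 over `v` is FULL
    have key277 : ∀ q₁ : PrimeSpectrum (HomogeneousLocalization.Away
        (reesGrading (Ideal.span ((fun e : Fin 5 →₀ ℕ => Ideal.Quotient.mk (Ideal.span {f}) (monomial e (1 : k))) '' (genSet 5 AL2 : Set (Fin 5 →₀ ℕ)))))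
        (reesT (Ideal.Quotient.mk (Ideal.span {f}) (monomial (chartM 5 AL2 CL 327 (277 : Fin 327)) (1 : k))) (mk_vertex_mem k f 277))),
        Ideal.span (Set.range fun j : Fin 5 => Ideal.Quotient.mk (Ideal.span {f}) (X j)) ≤
          ((affineBlowup.π _).base ((affineBlowup.chartι _ (mk_vertex_mem k f 277)).base q₁)).asIdeal →
        (affineBlowup.chartι _ (mk_vertex_mem k f 277)).base q₁ ≠ (Spec.map σ.toCommRingCatIso.hom ≫ affineBlowup.chartι _ (mk_vertex_mem k f 277)).base P₀ →
        FullCl 2 ((affineBlowup (Ideal.span ((fun e : Fin 5 →₀ ℕ => Ideal.Quotient.mk (Ideal.span {f}) (monomial e (1 : k))) ''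
          (genSet 5 AL2 : Set (Fin 5 →₀ ℕ))))).presheaf.stalk ((affineBlowup.chartι _ (mk_vertex_mem k f 277)).base q₁)) := by
      intro q₁ hov hne
      refine fullCl_of_PChart k f hf 277 (Or.inr rfl) σ hσ q₁ hov fun hEq => hne ?_
      rw [Scheme.Hom.comp_base, TopCat.coe_comp, Function.comp_apply]
      congr 1
      apply PrimeSpectrum.ext
      rw [Spec.map_apply, PrimeSpectrum.comap_asIdeal, hP₀, ← hEq, comap_iso_hom_map]
    by_cases hc : c.val = 266 ∨ c.val = 277
    · rcases hc with hc | hc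
      · have hc' : c = 266 := Fin.ext hc
        subst hc'
        obtain ⟨σ₆, hB₆, hσ₆⟩ := exists_modelEquiv k f hf 266
        by_cases hq : q₀.asIdeal.map (σ₆ : _ →+* MvPolynomial (Fin 5) k ⧸ Ideal.span {KLocCellKit.evalL k (G (266 : Fin 327))}) =
            (Ideal.span {x | x ∈ HS.map (KLocCellKit.evalL k)}).map (Ideal.Quotient.mk (Ideal.span {KLocCellKit.evalL k (G (266 : Fin 327))}))
        · obtain ⟨q₁, hq₁⟩ := mem_range_chart277_of_chart266_P k f σ₆ hB₆ q₀ hq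
          rw [← hq₁] at hover hy ⊢
          exact key277 q₁ hover hy
        · exact fullCl_of_PChart k f hf 266 (Or.inl rfl) σ₆ hσ₆ q₀ hover hq
      · have hc' : c = 277 := Fin.ext hc
        subst hc'
        exact key277 q₀ hover hy
    · exact fullCl_of_goodChart k f hf c (fun h => hc (Or.inl h)) (fun h => hc (Or.inr h)) q₀ hover

/-! ## §5 The storey in the two-storey letter (`X₁ = affineBlowup (𝔪·K)`) -/

set_option maxHeartbeats 1600000 in
-- one rewrite of the centre in a large statement
/-- ★★ **THE SAME, FOR `X₁ = affineBlowup (𝔪 · K)`** — the letter of the first storey of `FHalfRowOfTwoStoreys.fHalfConclusion_of_twoStoreys` (`Jτ = 𝔪̃`, `JK = K̃`):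
`span (x̄^A) = span (range x̄ⱼ) * span (x̄^(genSet 5 KL2))` (`FDStorey1Fan.span_A_eq_floor_mul_K`). [OURS · certificate instance] -/
theorem storey1_fullCl_off_P_mul (f : MvPolynomial (Fin 5) k) (hf : f = X 4 ^ 4 + X 0 ^ 5 * X 4 + X 0 ^ 6 + X 1 ^ 3 + X 2 ^ 3 + X 3 ^ 7) :
    ∃ ι : Spec (.of (MvPolynomial (Fin 5) k ⧸ Ideal.span {KLocCellKit.evalL k (G (277 : Fin 327))})) ⟶
        affineBlowup (Ideal.span (Set.range fun j : Fin 5 => Ideal.Quotient.mk (Ideal.span {f}) (X j)) *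
          Ideal.span ((fun e : Fin 5 →₀ ℕ => Ideal.Quotient.mk (Ideal.span {f}) (monomial e (1 : k))) '' (genSet 5 KL2 : Set (Fin 5 →₀ ℕ)))),
      IsOpenImmersion ι ∧
      (∀ q : Spec (.of (MvPolynomial (Fin 5) k ⧸ Ideal.span {KLocCellKit.evalL k (G (277 : Fin 327))})),
        ((affineBlowup.π _).base (ι.base q)).asIdeal.comap (Ideal.Quotient.mk (Ideal.span {f})) =
          q.asIdeal.comap ((Ideal.Quotient.mk (Ideal.span {KLocCellKit.evalL k (G (277 : Fin 327))})).comp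
            (aeval (fun j : Fin 5 => ∏ i : Fin 5, (X i : MvPolynomial (Fin 5) k) ^ Vq (277 : Fin 327) i j)).toRingHom)) ∧
      ∀ P₀ : Spec (.of (MvPolynomial (Fin 5) k ⧸ Ideal.span {KLocCellKit.evalL k (G (277 : Fin 327))})),
        P₀.asIdeal = (Ideal.span {x | x ∈ HS.map (KLocCellKit.evalL k)}).map (Ideal.Quotient.mk (Ideal.span {KLocCellKit.evalL k (G (277 : Fin 327))})) →
        ∀ y : ↥(affineBlowup (Ideal.span (Set.range fun j : Fin 5 => Ideal.Quotient.mk (Ideal.span {f}) (X j)) *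
          Ideal.span ((fun e : Fin 5 →₀ ℕ => Ideal.Quotient.mk (Ideal.span {f}) (monomial e (1 : k))) '' (genSet 5 KL2 : Set (Fin 5 →₀ ℕ))))),
          y ≠ ι.base P₀ →
          FullCl 2 ((affineBlowup (Ideal.span (Set.range fun j : Fin 5 => Ideal.Quotient.mk (Ideal.span {f}) (X j)) *
            Ideal.span ((fun e : Fin 5 →₀ ℕ => Ideal.Quotient.mk (Ideal.span {f}) (monomial e (1 : k))) '' (genSet 5 KL2 : Set (Fin 5 →₀ ℕ))))).presheaf.stalk y) := by
  rw [← span_A_eq_floor_mul_K k (Ideal.span {f})]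
  exact storey1_fullCl_off_P k f hf

end Summit.ResolutionOfSingularities.ResolutionOfSingularities.Theorems.FInjectiveMacaulayfication.FDStorey1BlowupFull

end
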